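import Summits.QuantumFields.BalabanUV.T4Continuum.Support.NE3CovariantAdjointTorus
import Summits.QuantumFields.BalabanUV.T4Continuum.Support.NE3SpectralCutGram
import HarnessLib

/-!
# NE3SpectralCutTorus (T⁴ programme, node NE3, row K1-inst of the owner's ruling ρ-g22-2, file 4∕4 = THE ROW'S END) — THE SPECTRAL CUT OF
# `D_W†D_W` AND THE COVARIANT HODGE DECOMPOSITION ON PERIODIC 𝔲(n)-VALUED FIELDS, IN LATTICE CURRENCY: S1 AND S2 OF ROUTE H♮, TYPED

NE3 (node U1b) formalisation swarm `b2b-balaban-t4-ne3-formalise-*`, leaf seat `b2b-balaban-t4-ne3-formalise-leaf-02` (gen 6), row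
**K1-inst** of the owner's ruling ρ-g22-2 («package `D_W` on periodic 𝔤-valued sections as a `LinearMap` between `PiLp` spaces», owner journal
l.17786 ∕ l.18064; design `HOME/t4/b2b-balaban-t4-ne3-p1/g22/D-ne3p1-g22-1.md` steps S1∕S2; my INTENT ∕ CLAIM `HOME/CLAIMS.log` l.18383).
THE ROW'S FILES: (1∕4) `NE3SpectralCutSymmetry` (abstract supplement to the owner's kit `NE3SpectralCut` p227224 ∕ `NE3SpectralCutGram` p227494),
(2∕4) `NE3HilbertSchmidtTorus` (the real Hilbert–Schmidt `PiLp` packaging and `DW W P`), (3∕4) `NE3CovariantAdjointTorus` (`D_W† = covDiv W`,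
the anti-involution `X ↦ −Xᴴ`, the torus Hodge split), (4∕4) `NE3SpectralCutTorus` (S2 and S1 in lattice currency + the S1∘S2 package).
THIS FILE instantiates the owner's kit (`NE3SpectralCutGram` BY NAME, `D := DW W P`, `F` = the finite torus) and reads everything back on the lattice
(`periodBox P` sums of `nhsNormSq`∕`hsR`; unitary `P`-periodic `W`, `1 ≤ P`).  All [folklore], 0 sorry; DATA defs `cutLow`, `cutHigh`:
§1 **S2** — `cutLow W P θ ζ` (= `c̃ = P_{<θ}ζ`) and `cutHigh W P θ ζ` (= `ζ′ = P_{≥θ}ζ`) := `extS ∘ lowPart∕highPart ∘ resS`; for a `P`-periodic `ζ`: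
   `cutLow + cutHigh = ζ`, both `P`-periodic, `ℝ`-linear in `ζ`, plain Pythagoras, and
   (i) **`mul_sum_nhsNormSq_cutHigh_le`**: `θ·Σ_x nhsNormSq (ζ′ x) ≤ Σ_x Σ_κ nhsNormSq (gaugeDir W ζ x κ)` — no small divisor above the cut;
   (ii) **`sum_nhsNormSq_covDiv_gaugeDir_cutLow_le`**: `Σ_x nhsNormSq (covDiv W (gaugeDir W c̃) x) ≤ θ·Σ_x Σ_κ nhsNormSq (gaugeDir W ζ x κ)` — `ρ = D_W†D_Wc̃` is small;
   (iii) **`sum_hsR_cutHigh_covDiv_gaugeDir_cutLow`** `= 0`, `sum_hsR_gaugeDir_cutHigh_cutLow = 0` — orthogonality across the cut; energies of the parts,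
   Pythagoras of energies; **`cutLow_mem_skewAdjoint`∕`cutHigh_mem_skewAdjoint`** (𝔲(n)-valued `ζ` ⇒ 𝔲(n)-valued parts, by file 1's `map_lowPart_eq_of_map_eq`
   with file 3's `gram_DW_starNegS`);
§2 **S1** — **`exists_covHodge`**: `P`-periodic `η`, `ζ` with `Y = η + gaugeDir W ζ`, `covDiv W η = 0`, `Σ‖Y‖² = Σ‖η‖² + Σ‖D_Wζ‖²`;
   **`exists_covHodge_skew`**: for 𝔲(n)-valued `Y` both may be taken 𝔲(n)-valued (file 3's `exists_torusHodge_fixed`);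
§3 **THE S1∘S2 PACKAGE `exists_covHodge_cut`** (`0 < θ`, 𝔲(n)-valued periodic `Y`): 𝔲(n)-valued periodic `η′`, `ζ′`, `c̃` with `Y = η′ + D_Wζ′`,
   `covDiv W η′ = covDiv W (D_Wc̃)` (`=: ρ`), (i) `θ·Σ‖ζ′‖² ≤ Σ‖Y‖²`, (ii) `Σ‖ρ‖² ≤ θ·Σ‖Y‖²`, (iii) `Σ hsR ζ′ ρ = 0`, `Σ‖Y‖² = Σ‖η′‖² + Σ‖D_Wζ′‖²` —
   the typed inputs of route H♮'s S3∕S4∕S7 (there `θ = λ* = (ε∕L^k)²`: `‖ζ′‖ ≤ (L^k∕ε)‖Y‖`, `‖ρ‖ ≤ (ε∕L^k)‖Y‖`, `⟨ζ′, ρ⟩ = 0`); consumed by row K6.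
HONEST FRAMING.  Finite-dimensional linear algebra on OUR lattice objects at ONE unitary background; nothing about Bałaban's minimisers;
(P♮)_W, (ML_w) at `W ≠ 1`, T-E_w and NE3 are NOT proved; spine PROVED 0∕9; finite T⁴ rung (B)+1 — NOT infinite volume, NOT mass gap, NOT
BetaPertH, NOT Clay.  ABSOLUTE RULE kept: no printed sentence is a hypothesis (context only: [Balaban1985Averaging] (17)–(19) pp. 20–21, the
normalised Hilbert–Schmidt scalar product; [Balaban1985Variational] (83) p. 290, the Landau-gauge restriction).  PLACEMENT:
`Summits/QuantumFields/BalabanUV/` (our frame); moves nothing.  HONEST DEPENDENCY: continuum YM on T⁴ ⇐ BetaPertH ∧ nine spine estimates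
(0/9 proved); BetaPertH ⇐ (D1) ∧ (D4) ∧ CAP+tail; G-an2-4 gates asym, D1 and NE2/3/4.
-/

set_option autoImplicit false

open scoped BigOperators InnerProductSpace Matrix
open Finset

namespace Summit.QuantumFields.BalabanUV.T4Continuum.NE3SpectralCutTorus

open Literature.MathematicalPhysics.QuantumFieldTheory.Balaban1983to89
open B7Prop1Explicit B7Prop2Explicit MatrixNorms
open T4AveragingDeficitWall (IsUnitaryCfg IsSkewDir Ad)
open T4AveragingDeficitWallBoundary (IsPeriodicCfg periodBox)
open AveragingDeficitPeriodicCounting (IsPeriodicDir)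
open BlockAveragePushDirGauge (gaugeDir isPeriodicDir_gaugeDir)
open NE3CovariantCalculus (hsR)
open NE3CovariantWeitzenbock (covDiv)
open NE3LandauOrbit (covDiv_add_period)
open NE3SpectralCut NE3SpectralCutGram NE3SpectralCutSymmetry
open NE3HilbertSchmidtTorus NE3HilbertSchmidtTorus.HSMat NE3CovariantAdjointTorus

noncomputable section

variable {d : ℕ} {n : Type*} [Fintype n] [DecidableEq n]

/-! ## §1 The spectral cut of `D_W†D_W` in lattice currency -/

/-- **`c̃ = P_{<θ} ζ`**: the LOW spectral part of (the torus restriction of) `ζ` for the Gram operator `D_W†D_W`, extended periodically. [folklore] -/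
def cutLow (W : Site d → Fin d → (Matrix n n ℂ)ˣ) (P : ℕ) [NeZero P] (θ : ℝ) (ζ : Site d → Matrix n n ℂ) : Site d → Matrix n n ℂ :=
  extS P (lowPart (gram_isSymmetric (DW (d := d) W P)) θ (resS P ζ))

/-- **`ζ′ = P_{≥θ} ζ`**: the HIGH spectral part of (the torus restriction of) `ζ` for `D_W†D_W`, extended periodically. [folklore] -/
def cutHigh (W : Site d → Fin d → (Matrix n n ℂ)ˣ) (P : ℕ) [NeZero P] (θ : ℝ) (ζ : Site d → Matrix n n ℂ) : Site d → Matrix n n ℂ :=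
  extS P (highPart (gram_isSymmetric (DW (d := d) W P)) θ (resS P ζ))

section Cut

variable {W : Site d → Fin d → (Matrix n n ℂ)ˣ} {P : ℕ} [NeZero P] {θ : ℝ} {ζ : Site d → Matrix n n ℂ}

/-- `resS (cutLow …) = lowPart … (resS ζ)`. [folklore] -/
theorem resS_cutLow (W : Site d → Fin d → (Matrix n n ℂ)ˣ) (P : ℕ) [NeZero P] (θ : ℝ) (ζ : Site d → Matrix n n ℂ) :
    resS P (cutLow W P θ ζ) = lowPart (gram_isSymmetric (DW (d := d) W P)) θ (resS P ζ) := resS_extS P _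

/-- `resS (cutHigh …) = highPart … (resS ζ)`. [folklore] -/
theorem resS_cutHigh (W : Site d → Fin d → (Matrix n n ℂ)ˣ) (P : ℕ) [NeZero P] (θ : ℝ) (ζ : Site d → Matrix n n ℂ) :
    resS P (cutHigh W P θ ζ) = highPart (gram_isSymmetric (DW (d := d) W P)) θ (resS P ζ) := resS_extS P _

/-- `cutLow` is `P`-periodic. [folklore] -/
theorem cutLow_add_period (W : Site d → Fin d → (Matrix n n ℂ)ˣ) (P : ℕ) [NeZero P] (θ : ℝ) (ζ : Site d → Matrix n n ℂ) (x : Site d) (τ : Fin d) :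
    cutLow W P θ ζ (x + (P : ℤ) • e τ) = cutLow W P θ ζ x := extS_add_period P _ x τ

/-- `cutHigh` is `P`-periodic. [folklore] -/
theorem cutHigh_add_period (W : Site d → Fin d → (Matrix n n ℂ)ˣ) (P : ℕ) [NeZero P] (θ : ℝ) (ζ : Site d → Matrix n n ℂ) (x : Site d) (τ : Fin d) :
    cutHigh W P θ ζ (x + (P : ℤ) • e τ) = cutHigh W P θ ζ x := extS_add_period P _ x τ

/-- **`c̃ + ζ′ = ζ`** for a `P`-periodic `ζ`. [folklore] -/
theorem cutLow_add_cutHigh (W : Site d → Fin d → (Matrix n n ℂ)ˣ) (P : ℕ) [NeZero P] (θ : ℝ)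
    (hζ : ∀ (x : Site d) (τ : Fin d), ζ (x + (P : ℤ) • e τ) = ζ x) (x : Site d) : cutLow W P θ ζ x + cutHigh W P θ ζ x = ζ x := by
  unfold cutLow cutHigh
  rw [← extS_add, lowPart_add_highPart, extS_resS P hζ]

/-- `ζ′ = ζ − c̃`. [folklore] -/
theorem cutHigh_eq_sub (W : Site d → Fin d → (Matrix n n ℂ)ˣ) (P : ℕ) [NeZero P] (θ : ℝ)
    (hζ : ∀ (x : Site d) (τ : Fin d), ζ (x + (P : ℤ) • e τ) = ζ x) (x : Site d) : cutHigh W P θ ζ x = ζ x - cutLow W P θ ζ x := by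
  rw [← cutLow_add_cutHigh W P θ hζ x]; abel

/-- `cutLow` is additive in `ζ`. [folklore] -/
theorem cutLow_add_fun (W : Site d → Fin d → (Matrix n n ℂ)ˣ) (P : ℕ) [NeZero P] (θ : ℝ) (ζ ξ : Site d → Matrix n n ℂ) (x : Site d) :
    cutLow W P θ (fun y => ζ y + ξ y) x = cutLow W P θ ζ x + cutLow W P θ ξ x := by
  unfold cutLow
  rw [resS_add, lowPart_add, extS_add]

/-- `cutLow` commutes with real scalars. [folklore] -/
theorem cutLow_smul_fun (W : Site d → Fin d → (Matrix n n ℂ)ˣ) (P : ℕ) [NeZero P] (θ : ℝ) (t : ℝ) (ζ : Site d → Matrix n n ℂ) (x : Site d) :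
    cutLow W P θ (fun y => t • ζ y) x = t • cutLow W P θ ζ x := by
  unfold cutLow
  have h : resS (d := d) P (fun y => t • ζ y) = t • resS P ζ := by ext s : 1; rfl
  rw [h, lowPart_smul, extS_smul]

/-- `cutHigh` is additive in `ζ`. [folklore] -/
theorem cutHigh_add_fun (W : Site d → Fin d → (Matrix n n ℂ)ˣ) (P : ℕ) [NeZero P] (θ : ℝ) (ζ ξ : Site d → Matrix n n ℂ) (x : Site d) :
    cutHigh W P θ (fun y => ζ y + ξ y) x = cutHigh W P θ ζ x + cutHigh W P θ ξ x := by
  unfold cutHigh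
  rw [resS_add, highPart_add, extS_add]

/-- `cutHigh` commutes with real scalars. [folklore] -/
theorem cutHigh_smul_fun (W : Site d → Fin d → (Matrix n n ℂ)ˣ) (P : ℕ) [NeZero P] (θ : ℝ) (t : ℝ) (ζ : Site d → Matrix n n ℂ) (x : Site d) :
    cutHigh W P θ (fun y => t • ζ y) x = t • cutHigh W P θ ζ x := by
  unfold cutHigh
  have h : resS (d := d) P (fun y => t • ζ y) = t • resS P ζ := by ext s : 1; rfl
  rw [h, highPart_smul, extS_smul]

/-- **PLAIN PYTHAGORAS**: `Σ nhsNormSq ζ = Σ nhsNormSq c̃ + Σ nhsNormSq ζ′` over the period box (`P`-periodic `ζ`). [folklore] -/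
theorem sum_nhsNormSq_eq_add (W : Site d → Fin d → (Matrix n n ℂ)ˣ) (P : ℕ) [NeZero P] (θ : ℝ)
    (hζ : ∀ (x : Site d) (τ : Fin d), ζ (x + (P : ℤ) • e τ) = ζ x) :
    ∑ x ∈ periodBox (d := d) P, nhsNormSq (ζ x)
      = ∑ x ∈ periodBox (d := d) P, nhsNormSq (cutLow W P θ ζ x) + ∑ x ∈ periodBox (d := d) P, nhsNormSq (cutHigh W P θ ζ x) := by
  unfold cutLow cutHigh
  rw [← norm_sq_eq_sum_extS, ← norm_sq_eq_sum_extS, ← norm_sq_eq_add]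
  conv_lhs => rw [← extS_resS P hζ]
  rw [← norm_sq_eq_sum_extS]

/-- The parts are `hsR`-orthogonal over the period box. [folklore] -/
theorem sum_hsR_cutLow_cutHigh (W : Site d → Fin d → (Matrix n n ℂ)ˣ) (P : ℕ) [NeZero P] (θ : ℝ) (ζ : Site d → Matrix n n ℂ) :
    ∑ x ∈ periodBox (d := d) P, hsR (cutLow W P θ ζ x) (cutHigh W P θ ζ x) = 0 := by
  unfold cutLow cutHigh
  rw [← inner_eq_sum_extS, inner_lowPart_highPart]

/-- **(i) NO SMALL DIVISOR ABOVE THE CUT**: `θ·Σ_x nhsNormSq (ζ′ x) ≤ Σ_x Σ_κ nhsNormSq (D_Wζ x κ)` (`0 < θ`, `P`-periodic `ζ`). [folklore] -/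
theorem mul_sum_nhsNormSq_cutHigh_le (W : Site d → Fin d → (Matrix n n ℂ)ˣ) (P : ℕ) [NeZero P] (hθ : 0 < θ)
    (hζ : ∀ (x : Site d) (τ : Fin d), ζ (x + (P : ℤ) • e τ) = ζ x) :
    θ * ∑ x ∈ periodBox (d := d) P, nhsNormSq (cutHigh W P θ ζ x)
      ≤ ∑ x ∈ periodBox (d := d) P, ∑ κ : Fin d, nhsNormSq (gaugeDir W ζ x κ) := by
  have h := norm_sq_highPart_gram_le (DW (d := d) W P) hθ (resS P ζ)
  rw [norm_sq_DW_resS W P hζ, norm_sq_eq_sum_extS] at h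
  have h' := mul_le_mul_of_nonneg_left h hθ.le
  rwa [← mul_assoc, mul_inv_cancel₀ hθ.ne', one_mul] at h'

/-- (i′) the same as `Σ_x nhsNormSq (ζ′ x) ≤ θ⁻¹·Σ_x Σ_κ nhsNormSq (D_Wζ x κ)`. [folklore] -/
theorem sum_nhsNormSq_cutHigh_le (W : Site d → Fin d → (Matrix n n ℂ)ˣ) (P : ℕ) [NeZero P] (hθ : 0 < θ)
    (hζ : ∀ (x : Site d) (τ : Fin d), ζ (x + (P : ℤ) • e τ) = ζ x) :
    ∑ x ∈ periodBox (d := d) P, nhsNormSq (cutHigh W P θ ζ x)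
      ≤ θ⁻¹ * ∑ x ∈ periodBox (d := d) P, ∑ κ : Fin d, nhsNormSq (gaugeDir W ζ x κ) := by
  have h := norm_sq_highPart_gram_le (DW (d := d) W P) hθ (resS P ζ)
  rwa [norm_sq_DW_resS W P hζ, norm_sq_eq_sum_extS] at h

/-- **(ii) THE LOW PART'S COVARIANT LAPLACIAN `ρ = D_W†D_W c̃` IS SMALL**:
`Σ_x nhsNormSq (covDiv W (D_W c̃) x) ≤ θ·Σ_x Σ_κ nhsNormSq (D_Wζ x κ)` (`0 ≤ θ`, unitary `P`-periodic `W`, `1 ≤ P`). [folklore] -/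
theorem sum_nhsNormSq_covDiv_gaugeDir_cutLow_le (hWu : IsUnitaryCfg W) (hP : 1 ≤ P) (hWP : IsPeriodicCfg W (P : ℤ)) (hθ : 0 ≤ θ)
    (hζ : ∀ (x : Site d) (τ : Fin d), ζ (x + (P : ℤ) • e τ) = ζ x) :
    ∑ x ∈ periodBox (d := d) P, nhsNormSq (covDiv W (gaugeDir W (cutLow W P θ ζ)) x)
      ≤ θ * ∑ x ∈ periodBox (d := d) P, ∑ κ : Fin d, nhsNormSq (gaugeDir W ζ x κ) := by
  have h := norm_sq_gram_lowPart_le (DW (d := d) W P) hθ (resS P ζ)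
  rwa [norm_sq_DW_resS W P hζ, norm_sq_eq_sum_extS, extS_gram_DW hWu hP hWP] at h

/-- **(iii) ORTHOGONALITY ACROSS THE CUT**: `Σ_x hsR (ζ′ x) (covDiv W (D_W c̃) x) = 0` (unitary `P`-periodic `W`, `1 ≤ P`). [folklore] -/
theorem sum_hsR_cutHigh_covDiv_gaugeDir_cutLow (hWu : IsUnitaryCfg W) (hP : 1 ≤ P) (hWP : IsPeriodicCfg W (P : ℤ)) (θ : ℝ)
    (ζ : Site d → Matrix n n ℂ) :
    ∑ x ∈ periodBox (d := d) P, hsR (cutHigh W P θ ζ x) (covDiv W (gaugeDir W (cutLow W P θ ζ)) x) = 0 := by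
  have h := inner_highPart_gram_lowPart (DW (d := d) W P) θ (resS P ζ)
  rwa [inner_eq_sum_extS, extS_gram_DW hWu hP hWP] at h

/-- (iii′) the same orthogonality on `D_W`: `Σ_x Σ_κ hsR (D_Wζ′ x κ) (D_Wc̃ x κ) = 0`. [folklore] -/
theorem sum_hsR_gaugeDir_cutHigh_cutLow (W : Site d → Fin d → (Matrix n n ℂ)ˣ) (P : ℕ) [NeZero P] (θ : ℝ) (ζ : Site d → Matrix n n ℂ) :
    ∑ x ∈ periodBox (d := d) P, ∑ κ : Fin d, hsR (gaugeDir W (cutHigh W P θ ζ) x κ) (gaugeDir W (cutLow W P θ ζ) x κ) = 0 := by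
  have h := inner_apply_highPart_apply_lowPart (DW (d := d) W P) θ (resS P ζ)
  rwa [DW_apply, DW_apply, inner_resF] at h

/-- Energy of the high part: `Σ‖D_Wζ′‖² ≤ Σ‖D_Wζ‖²` (`P`-periodic `ζ`). [folklore] -/
theorem sum_nhsNormSq_gaugeDir_cutHigh_le (W : Site d → Fin d → (Matrix n n ℂ)ˣ) (P : ℕ) [NeZero P] (θ : ℝ)
    (hζ : ∀ (x : Site d) (τ : Fin d), ζ (x + (P : ℤ) • e τ) = ζ x) :
    ∑ x ∈ periodBox (d := d) P, ∑ κ : Fin d, nhsNormSq (gaugeDir W (cutHigh W P θ ζ) x κ)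
      ≤ ∑ x ∈ periodBox (d := d) P, ∑ κ : Fin d, nhsNormSq (gaugeDir W ζ x κ) := by
  have h := norm_sq_apply_highPart_le (DW (d := d) W P) θ (resS P ζ)
  rwa [norm_sq_DW_resS W P hζ, norm_sq_DW] at h

/-- Energy of the low part: `Σ‖D_Wc̃‖² ≤ Σ‖D_Wζ‖²` (`P`-periodic `ζ`). [folklore] -/
theorem sum_nhsNormSq_gaugeDir_cutLow_le (W : Site d → Fin d → (Matrix n n ℂ)ˣ) (P : ℕ) [NeZero P] (θ : ℝ)
    (hζ : ∀ (x : Site d) (τ : Fin d), ζ (x + (P : ℤ) • e τ) = ζ x) :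
    ∑ x ∈ periodBox (d := d) P, ∑ κ : Fin d, nhsNormSq (gaugeDir W (cutLow W P θ ζ) x κ)
      ≤ ∑ x ∈ periodBox (d := d) P, ∑ κ : Fin d, nhsNormSq (gaugeDir W ζ x κ) := by
  have h := norm_sq_apply_lowPart_le' (DW (d := d) W P) θ (resS P ζ)
  rwa [norm_sq_DW_resS W P hζ, norm_sq_DW] at h

/-- **PYTHAGORAS OF THE ENERGIES**: `Σ‖D_Wζ‖² = Σ‖D_Wc̃‖² + Σ‖D_Wζ′‖²` (`P`-periodic `ζ`). [folklore] -/
theorem sum_nhsNormSq_gaugeDir_eq_add (W : Site d → Fin d → (Matrix n n ℂ)ˣ) (P : ℕ) [NeZero P] (θ : ℝ)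
    (hζ : ∀ (x : Site d) (τ : Fin d), ζ (x + (P : ℤ) • e τ) = ζ x) :
    ∑ x ∈ periodBox (d := d) P, ∑ κ : Fin d, nhsNormSq (gaugeDir W ζ x κ)
      = ∑ x ∈ periodBox (d := d) P, ∑ κ : Fin d, nhsNormSq (gaugeDir W (cutLow W P θ ζ) x κ)
        + ∑ x ∈ periodBox (d := d) P, ∑ κ : Fin d, nhsNormSq (gaugeDir W (cutHigh W P θ ζ) x κ) := by
  have h := NE3SpectralCutGram.norm_sq_apply_eq_add (DW (d := d) W P) θ (resS P ζ)
  rwa [norm_sq_DW_resS W P hζ, norm_sq_DW, norm_sq_DW] at h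

/-- **A 𝔲(n)-VALUED `ζ` HAS A 𝔲(n)-VALUED LOW PART** (unitary `P`-periodic `W`, `1 ≤ P`): the cut commutes with `X ↦ −Xᴴ`. [folklore] -/
theorem cutLow_mem_skewAdjoint (hWu : IsUnitaryCfg W) (hP : 1 ≤ P) (hWP : IsPeriodicCfg W (P : ℤ)) (θ : ℝ)
    (hζs : ∀ x : Site d, ζ x ∈ skewAdjoint (Matrix n n ℂ)) (x : Site d) : cutLow W P θ ζ x ∈ skewAdjoint (Matrix n n ℂ) := by
  have hfix := map_lowPart_eq_of_map_eq (gram_isSymmetric (DW (d := d) W P)) θ (starNegS P)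
    (gram_DW_starNegS hWu hP hWP) (starNegS_resS_of_skew P hζs)
  -- read the fixed-point identity at the site `x`
  have hx := congrArg (fun a : Sec d n P => extS P a x) hfix
  simp only [extS_starNegS] at hx
  rw [skewAdjoint.mem_iff, Matrix.star_eq_conjTranspose]
  exact neg_eq_iff_eq_neg.mp hx

/-- … and a 𝔲(n)-valued high part (`P`-periodic 𝔲(n)-valued `ζ`). [folklore] -/
theorem cutHigh_mem_skewAdjoint (hWu : IsUnitaryCfg W) (hP : 1 ≤ P) (hWP : IsPeriodicCfg W (P : ℤ)) (θ : ℝ)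
    (hζ : ∀ (x : Site d) (τ : Fin d), ζ (x + (P : ℤ) • e τ) = ζ x) (hζs : ∀ x : Site d, ζ x ∈ skewAdjoint (Matrix n n ℂ)) (x : Site d) :
    cutHigh W P θ ζ x ∈ skewAdjoint (Matrix n n ℂ) := by
  rw [cutHigh_eq_sub W P θ hζ x]
  exact (skewAdjoint (Matrix n n ℂ)).sub_mem (hζs x) (cutLow_mem_skewAdjoint hWu hP hWP θ hζs x)

end Cut


/-! ## §2 S1 in lattice currency -/

section Lattice

variable {W : Site d → Fin d → (Matrix n n ℂ)ˣ} {P : ℕ} [NeZero P] {Y : Site d → Fin d → Matrix n n ℂ}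

/-- Reading a torus splitting `resF Y = D_W a + z` back on the lattice. [folklore] -/
theorem lattice_of_torusHodge (hWu : IsUnitaryCfg W) (hP : 1 ≤ P) (hWP : IsPeriodicCfg W (P : ℤ)) (hY : IsPeriodicDir Y (P : ℤ))
    {a : Sec d n P} {z : Form d n P} (hYaz : resF P Y = DW W P a + z) (hz0 : LinearMap.adjoint (DW W P) z = 0)
    (horth : ⟪DW W P a, z⟫_ℝ = 0) :
    (∀ (x : Site d) (κ : Fin d), Y x κ = extF P z x κ + gaugeDir W (extS P a) x κ) ∧ (∀ x : Site d, covDiv W (extF P z) x = 0) ∧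
      ∑ x ∈ periodBox (d := d) P, ∑ κ : Fin d, nhsNormSq (Y x κ)
        = ∑ x ∈ periodBox (d := d) P, ∑ κ : Fin d, nhsNormSq (extF P z x κ)
          + ∑ x ∈ periodBox (d := d) P, ∑ κ : Fin d, nhsNormSq (gaugeDir W (extS P a) x κ) := by
  refine ⟨fun x κ => ?_, (adjoint_DW_eq_zero_iff hWu hP hWP z).1 hz0, ?_⟩
  · have h := congrArg (fun c : Form d n P => extF P c x κ) hYaz
    simp only [extF_resF P hY, extF_add, extF_DW hWP] at h
    rw [h, add_comm]
  · have hpy : ‖resF P Y‖ ^ 2 = ‖z‖ ^ 2 + ‖DW W P a‖ ^ 2 := by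
      rw [hYaz, add_comm (DW W P a) z]
      have h0 : ⟪z, DW W P a⟫_ℝ = 0 := by rw [real_inner_comm]; exact horth
      rw [← real_inner_self_eq_norm_sq, inner_add_left, inner_add_right, inner_add_right, h0, real_inner_comm z (DW W P a), h0,
        real_inner_self_eq_norm_sq, real_inner_self_eq_norm_sq]
      ring
    rw [norm_sq_resF, norm_sq_eq_sum_extF, norm_sq_DW] at hpy
    exact hpy

/-- **S1 — THE COVARIANT HODGE DECOMPOSITION ON THE FINITE TORUS**: for a unitary `P`-periodic background `W` (`1 ≤ P`) and a `P`-periodic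
direction field `Y` there are a `P`-periodic co-closed `η` (`covDiv W η = 0`) and a `P`-periodic potential `ζ` with `Y = η + D_Wζ` and
`Σ‖Y‖² = Σ‖η‖² + Σ‖D_Wζ‖²` over the period box. [folklore] -/
theorem exists_covHodge (hWu : IsUnitaryCfg W) (hP : 1 ≤ P) (hWP : IsPeriodicCfg W (P : ℤ)) (hY : IsPeriodicDir Y (P : ℤ)) :
    ∃ η : Site d → Fin d → Matrix n n ℂ, ∃ ζ : Site d → Matrix n n ℂ,
      IsPeriodicDir η (P : ℤ) ∧ (∀ (x : Site d) (τ : Fin d), ζ (x + (P : ℤ) • e τ) = ζ x) ∧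
      (∀ (x : Site d) (κ : Fin d), Y x κ = η x κ + gaugeDir W ζ x κ) ∧ (∀ x : Site d, covDiv W η x = 0) ∧
      ∑ x ∈ periodBox (d := d) P, ∑ κ : Fin d, nhsNormSq (Y x κ)
        = ∑ x ∈ periodBox (d := d) P, ∑ κ : Fin d, nhsNormSq (η x κ)
          + ∑ x ∈ periodBox (d := d) P, ∑ κ : Fin d, nhsNormSq (gaugeDir W ζ x κ) := by
  obtain ⟨a, z, hYaz, -, hz0, horth⟩ := exists_torusHodge W P (resF P Y)
  obtain ⟨h1, h2, h3⟩ := lattice_of_torusHodge hWu hP hWP hY hYaz hz0 horth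
  exact ⟨extF P z, extS P a, isPeriodicDir_extF P z, extS_add_period P a, h1, h2, h3⟩

/-- **S1 FOR 𝔲(n)-VALUED FIELDS**: if `Y` is 𝔲(n)-valued, `η` and `ζ` may be taken 𝔲(n)-valued. [folklore] -/
theorem exists_covHodge_skew (hWu : IsUnitaryCfg W) (hP : 1 ≤ P) (hWP : IsPeriodicCfg W (P : ℤ)) (hY : IsPeriodicDir Y (P : ℤ))
    (hYs : IsSkewDir Y) :
    ∃ η : Site d → Fin d → Matrix n n ℂ, ∃ ζ : Site d → Matrix n n ℂ,
      IsPeriodicDir η (P : ℤ) ∧ (∀ (x : Site d) (τ : Fin d), ζ (x + (P : ℤ) • e τ) = ζ x) ∧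
      IsSkewDir η ∧ (∀ x : Site d, ζ x ∈ skewAdjoint (Matrix n n ℂ)) ∧
      (∀ (x : Site d) (κ : Fin d), Y x κ = η x κ + gaugeDir W ζ x κ) ∧ (∀ x : Site d, covDiv W η x = 0) ∧
      ∑ x ∈ periodBox (d := d) P, ∑ κ : Fin d, nhsNormSq (Y x κ)
        = ∑ x ∈ periodBox (d := d) P, ∑ κ : Fin d, nhsNormSq (η x κ)
          + ∑ x ∈ periodBox (d := d) P, ∑ κ : Fin d, nhsNormSq (gaugeDir W ζ x κ) := by
  obtain ⟨a, z, hYaz, hz0, horth, ha, hz⟩ := exists_torusHodge_fixed hWu hP (starNegF_resF_of_skew P hYs)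
  obtain ⟨h1, h2, h3⟩ := lattice_of_torusHodge hWu hP hWP hY hYaz hz0 horth
  exact ⟨extF P z, extS P a, isPeriodicDir_extF P z, extS_add_period P a, isSkewDir_extF_of_fixed P hz,
    extS_mem_skewAdjoint_of_fixed P ha, h1, h2, h3⟩


/-! ## §3 The S1∘S2 package: `Y = η′ + D_Wζ′` with the cut in place -/

/-- **S1∘S2 OF ROUTE H♮, TYPED**: for a unitary `P`-periodic background `W` (`1 ≤ P`), a threshold `0 < θ` and a `P`-periodic 𝔲(n)-valued
direction field `Y`, there are `P`-periodic 𝔲(n)-valued `η′` (1-form), `ζ′`, `c̃` (sections) with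
`Y = η′ + D_Wζ′`, `covDiv W η′ = covDiv W (D_Wc̃)` (`=: ρ`, the low part's covariant Laplacian), and over the period box:
(i) `θ·Σ‖ζ′‖² ≤ Σ‖Y‖²`; (ii) `Σ‖ρ‖² ≤ θ·Σ‖Y‖²`; (iii) `Σ hsR ζ′ ρ = 0`; `Σ‖Y‖² = Σ‖η′‖² + Σ‖D_Wζ′‖²`.
(Take the Hodge potential `ζ` of S1, `c̃ = cutLow W P θ ζ`, `ζ′ = cutHigh W P θ ζ`, `η′ = η + D_Wc̃`.) [folklore] -/
theorem exists_covHodge_cut (hWu : IsUnitaryCfg W) (hP : 1 ≤ P) (hWP : IsPeriodicCfg W (P : ℤ)) {θ : ℝ} (hθ : 0 < θ)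
    (hY : IsPeriodicDir Y (P : ℤ)) (hYs : IsSkewDir Y) :
    ∃ η' : Site d → Fin d → Matrix n n ℂ, ∃ ζ' c : Site d → Matrix n n ℂ,
      IsPeriodicDir η' (P : ℤ) ∧ (∀ (x : Site d) (τ : Fin d), ζ' (x + (P : ℤ) • e τ) = ζ' x) ∧
      (∀ (x : Site d) (τ : Fin d), c (x + (P : ℤ) • e τ) = c x) ∧
      IsSkewDir η' ∧ (∀ x : Site d, ζ' x ∈ skewAdjoint (Matrix n n ℂ)) ∧ (∀ x : Site d, c x ∈ skewAdjoint (Matrix n n ℂ)) ∧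
      (∀ (x : Site d) (κ : Fin d), Y x κ = η' x κ + gaugeDir W ζ' x κ) ∧
      (∀ x : Site d, covDiv W η' x = covDiv W (gaugeDir W c) x) ∧
      θ * ∑ x ∈ periodBox (d := d) P, nhsNormSq (ζ' x) ≤ ∑ x ∈ periodBox (d := d) P, ∑ κ : Fin d, nhsNormSq (Y x κ) ∧
      ∑ x ∈ periodBox (d := d) P, nhsNormSq (covDiv W η' x) ≤ θ * ∑ x ∈ periodBox (d := d) P, ∑ κ : Fin d, nhsNormSq (Y x κ) ∧
      ∑ x ∈ periodBox (d := d) P, hsR (ζ' x) (covDiv W η' x) = 0 ∧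
      ∑ x ∈ periodBox (d := d) P, ∑ κ : Fin d, nhsNormSq (Y x κ)
        = ∑ x ∈ periodBox (d := d) P, ∑ κ : Fin d, nhsNormSq (η' x κ)
          + ∑ x ∈ periodBox (d := d) P, ∑ κ : Fin d, nhsNormSq (gaugeDir W ζ' x κ) := by
  obtain ⟨η, ζ, hηP, hζP, hηs, hζs, hY', hdiv, hpy⟩ := exists_covHodge_skew hWu hP hWP hY hYs
  set c := cutLow W P θ ζ with hc
  set ζ' := cutHigh W P θ ζ with hζ'
  have hcP : ∀ (x : Site d) (τ : Fin d), c (x + (P : ℤ) • e τ) = c x := cutLow_add_period W P θ ζ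
  -- η′ := η + D_W c̃
  refine ⟨fun x κ => η x κ + gaugeDir W c x κ, ζ', c, ?_, cutHigh_add_period W P θ ζ, hcP, ?_,
    cutHigh_mem_skewAdjoint hWu hP hWP θ hζP hζs, cutLow_mem_skewAdjoint hWu hP hWP θ hζs, ?_, ?_, ?_, ?_, ?_, ?_⟩
  · -- periodicity of η′
    intro x τ κ
    show η (x + (P : ℤ) • e τ) κ + gaugeDir W c (x + (P : ℤ) • e τ) κ = η x κ + gaugeDir W c x κ
    rw [hηP x τ κ, isPeriodicDir_gaugeDir hWP hcP x τ κ]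
  · -- skewness of η′
    intro x κ
    exact (skewAdjoint (Matrix n n ℂ)).add_mem (hηs x κ) (NE3LandauOrbit.gaugeDir_skew hWu (cutLow_mem_skewAdjoint hWu hP hWP θ hζs) x κ)
  · -- Y = η′ + D_W ζ′
    intro x κ
    show Y x κ = η x κ + gaugeDir W c x κ + gaugeDir W ζ' x κ
    rw [hY' x κ, add_assoc, ← gaugeDir_add_fun]
    congr 2
    funext y
    exact (cutLow_add_cutHigh W P θ hζP y).symm
  · -- covDiv η′ = covDiv (D_W c̃)
    intro x
    rw [covDiv_add_fun, hdiv x, zero_add]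
  · -- (i)
    have h := mul_sum_nhsNormSq_cutHigh_le W P hθ hζP
    have hD : ∑ x ∈ periodBox (d := d) P, ∑ κ : Fin d, nhsNormSq (gaugeDir W ζ x κ)
        ≤ ∑ x ∈ periodBox (d := d) P, ∑ κ : Fin d, nhsNormSq (Y x κ) := by
      rw [hpy]
      have h0 : 0 ≤ ∑ x ∈ periodBox (d := d) P, ∑ κ : Fin d, nhsNormSq (η x κ) :=
        Finset.sum_nonneg fun _ _ => Finset.sum_nonneg fun _ _ => nhsNormSq_nonneg _
      linarith
    exact h.trans hD
  · -- (ii)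
    have h := sum_nhsNormSq_covDiv_gaugeDir_cutLow_le (θ := θ) hWu hP hWP hθ.le hζP
    have hD : ∑ x ∈ periodBox (d := d) P, ∑ κ : Fin d, nhsNormSq (gaugeDir W ζ x κ)
        ≤ ∑ x ∈ periodBox (d := d) P, ∑ κ : Fin d, nhsNormSq (Y x κ) := by
      rw [hpy]
      have h0 : 0 ≤ ∑ x ∈ periodBox (d := d) P, ∑ κ : Fin d, nhsNormSq (η x κ) :=
        Finset.sum_nonneg fun _ _ => Finset.sum_nonneg fun _ _ => nhsNormSq_nonneg _
      linarith
    have e1 : ∑ x ∈ periodBox (d := d) P, nhsNormSq (covDiv W (fun y κ => η y κ + gaugeDir W c y κ) x)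
        = ∑ x ∈ periodBox (d := d) P, nhsNormSq (covDiv W (gaugeDir W c) x) :=
      Finset.sum_congr rfl fun x _ => by rw [covDiv_add_fun, hdiv x, zero_add]
    rw [e1]
    exact h.trans (mul_le_mul_of_nonneg_left hD hθ.le)
  · -- (iii)
    have e1 : ∑ x ∈ periodBox (d := d) P, hsR (ζ' x) (covDiv W (fun y κ => η y κ + gaugeDir W c y κ) x)
        = ∑ x ∈ periodBox (d := d) P, hsR (ζ' x) (covDiv W (gaugeDir W c) x) :=
      Finset.sum_congr rfl fun x _ => by rw [covDiv_add_fun, hdiv x, zero_add]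
    rw [e1]
    exact sum_hsR_cutHigh_covDiv_gaugeDir_cutLow hWu hP hWP θ ζ
  · -- Pythagoras for (η′, ζ′): ‖Y‖² = ‖η‖² + ‖D c̃‖² + ‖D ζ′‖² and ‖η′‖² = ‖η‖² + ‖D c̃‖²
    have hE := sum_nhsNormSq_gaugeDir_eq_add W P θ hζP
    -- ‖η′‖² = ‖η‖² + ‖D c̃‖²: η ⊥ every gauge direction (covDiv W η = 0)
    have hη' : ∑ x ∈ periodBox (d := d) P, ∑ κ : Fin d, nhsNormSq (η x κ + gaugeDir W c x κ)
        = ∑ x ∈ periodBox (d := d) P, ∑ κ : Fin d, nhsNormSq (η x κ)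
          + ∑ x ∈ periodBox (d := d) P, ∑ κ : Fin d, nhsNormSq (gaugeDir W c x κ) :=
      NE3LandauOrbit.sum_nhsNormSq_add_gaugeDir hP hWu hηP hcP fun x _ => hdiv x
    rw [hpy, hE, hη', add_assoc]

end Lattice


end

end Summit.QuantumFields.BalabanUV.T4Continuum.NE3SpectralCutTorus
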